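import Summits.SmoothPoincare4.SmoothPoincare4.Theorems.CongruenceShadowsNormalFormStablyTrivialLuftStubGateAscent
import Summits.SmoothPoincare4.SmoothPoincare4.Theorems.CongruenceShadowsNormalFormStablyTrivialLuftStubFreePadding
import Summits.SmoothPoincare4.SmoothPoincare4.Theorems.CongruenceShadowsNormalFormStablyTrivialLuftStubMovesGoeritz
import Summits.SmoothPoincare4.SmoothPoincare4.Theorems.CongruenceShadowsNormalFormStablyTrivialLuftStubEraseStabilize
import Summits.SmoothPoincare4.SmoothPoincare4.Theorems.CongruenceShadowsNormalFormStablyTrivialLuftStubPaddingTransfer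

/-!
# Line `luft-twist-reduction` for crux `NormalFormStablyTrivial` (stmt-SmoothPoincare4-14591):
# the LUFT REDUCTION assembled — modulo Nielsen's lifting theorem the crux IS the twist gate

With the five provable stubs of skeleton v2 landed (`stub_gateAscent` p128901, `stub_freePadding`
p129851, `stub_movesGoeritz` p131289, `stub_eraseStabilize` p132237, `stub_paddingTransfer`
p132501; vocabulary and composition `…LuftDefs.lean` p128507), this file records the line's
theorem:

* `goeritzPadding_of_nielsen` — Nielsen ⇒ GOERITZ PADDING: every gate triple `K` at level `m`
  becomes after `m+1` stabilisations a gate triple whose `(1,2)` pair closure `K₂N₁` is the image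
  of the standard one `N₂N₁` under an element of the Goeritz group `Stab N₀ ∩ Stab N₁` (stable
  padding of the free shadow, TRIAGE-r1-2 App. A, realised by handle slides over trivial handles
  and drags of trivial handles; Nielsen enters only through the ascent of the two gate
  automorphisms);
* `luftReduction_of_nielsen` — Nielsen ⇒ LUFT REDUCTION: every gate triple is stably `Iso`, by a
  Goeritz element, to a gate triple with standard free shadow `K₂ ⊔ N₁ = N₂ ⊔ N₁`;
* `normalFormStablyTrivial_of_nielsen_of_twistGate` — **Nielsen ∧ TwistGate ⇒ the crux**, and
  `twistGate_of_normalFormStablyTrivial` — **the crux ⇒ TwistGate** (unconditionally): modulo the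
  classical named fact `nielsen_surfaceGroup_mulEquiv_lift` (Nielsen 1927) the crux is EQUIVALENT
  to its restriction to the sub-locus `{K₂N₁ = N₂N₁}` of gate triples with standard free shadow
  (`normalFormStablyTrivial_iff_twistGate_of_nielsen`).  Geometric reading: a homotopy 4-sphere in
  `(3+3m; m+1)` Waldhausen normal form may be assumed, stably, to be glued from the standard
  trisection of `S⁴` by a regluing of `H₂` that acts trivially on `π₁(H₁)` modulo `N₁` — all
  free-group / `Out(F)` data of the gluing are standard; what homotopy cannot see and isotopy must
  is exactly the residual.

Calibration (§2): the standard triple is a gate triple with standard free shadow and is stably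
trivial (`twistGate_std`: non-vacuity/tightness of the residual at the standard model); every
TWIST-GLUED triple `(N₀, N₁, t N₂)` with `t ∈ Stab N₁` acting innerly modulo `N₁`
(`ActsInnerlyModN1`, a Luft twist of `H₁`; Luft 1978, McCullough 1985) lies on the locus of
`TwistGate` (`freeShadowStandard_of_twist`) — so does Disproof §6's `ℂP²` witness `T_{b₁}N₂`,
which is NOT a gate triple: inside `TwistGate` the `β`-datum of `InGate` is load-bearing.

No `sorry`; one definition (`ActsInnerlyModN1`, the calibration predicate); nothing here closes
the crux (TwistGate is SPC4-sandwiched: `twistGate_of_normalFormStablyTrivial` and AGK Cor. 6 +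
`WaldhausenPairs`).
-/

-- the prescribed namespace `Summit.<P>.<Sub>.…` duplicates `SmoothPoincare4` (P = Sub)
set_option linter.dupNamespace false

noncomputable section

namespace Summit.SmoothPoincare4.SmoothPoincare4.Theorems.NormalFormStablyTrivial.Luft

open Literature.Topology.FourManifolds
open Summit.SmoothPoincare4.SmoothPoincare4.Theses.CongruenceShadows (NormalFormStablyTrivial)
open Summit.SmoothPoincare4.SmoothPoincare4.Theorems.NormalFormStablyTrivial.Negative
  (normalFormStablyTrivial_iff_gate_of_nielsen isStablyTrivial_of_inGate)

/-- **Nielsen ⇒ Goeritz padding** (the four bookkeeping/algebra stubs assembled by the transfer). -/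
theorem goeritzPadding_of_nielsen (hN : nielsen_surfaceGroup_mulEquiv_lift) : GoeritzPadding :=
  stub_paddingTransfer (stub_gateAscent hN) stub_freePadding stub_movesGoeritz stub_eraseStabilize

/-- **Nielsen ⇒ Luft reduction**: every gate triple is stably isomorphic, by a Goeritz element, to a
gate triple with standard free shadow. -/
theorem luftReduction_of_nielsen (hN : nielsen_surfaceGroup_mulEquiv_lift) : LuftReduction :=
  luftReduction_of_goeritzPadding (goeritzPadding_of_nielsen hN)

/-- **Nielsen ∧ TwistGate ⇒ the crux** (skeleton v2 with its five provable stubs discharged). -/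
theorem normalFormStablyTrivial_of_nielsen_of_twistGate :
    nielsen_surfaceGroup_mulEquiv_lift → TwistGate → NormalFormStablyTrivial :=
  fun hN hT => NormalFormStablyTrivial_of hN (stub_gateAscent hN) stub_freePadding stub_movesGoeritz
    stub_eraseStabilize stub_paddingTransfer hT

/-- **The crux ⇒ TwistGate** (unconditionally: the twist gate is the crux on a sub-locus), so
`TwistGate` is not refutable short of an exotic `S⁴`. -/
theorem twistGate_of_normalFormStablyTrivial : NormalFormStablyTrivial → TwistGate :=
  fun h m K hK _ => isStablyTrivial_of_inGate h m K hK

/-- **Modulo Nielsen the crux IS the twist gate.** -/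
theorem normalFormStablyTrivial_iff_twistGate_of_nielsen (hN : nielsen_surfaceGroup_mulEquiv_lift) :
    NormalFormStablyTrivial ↔ TwistGate :=
  ⟨twistGate_of_normalFormStablyTrivial, normalFormStablyTrivial_of_nielsen_of_twistGate hN⟩

/-- The gate form of the same equivalence: modulo Nielsen, "every gate triple is stably trivial"
is equivalent to "every gate triple WITH STANDARD FREE SHADOW is stably trivial". -/
theorem gate_iff_twistGate_of_nielsen (hN : nielsen_surfaceGroup_mulEquiv_lift) :
    (∀ (m : ℕ) (K : TrisectionKernels (3 + 3 * m)),
      Summit.SmoothPoincare4.SmoothPoincare4.Theorems.NormalFormStablyTrivial.Negative.InGate m K →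
        K.IsStablyTrivial) ↔ TwistGate :=
  (normalFormStablyTrivial_iff_gate_of_nielsen hN).symm.trans
    (normalFormStablyTrivial_iff_twistGate_of_nielsen hN)


/-! ## Calibration of the residual: non-vacuity and the twist-glued family -/

/-- **The standard triple is a gate triple** (`β = γ = 1`, `π₁ = 1`): the hypotheses of `TwistGate`
are satisfiable at every level, and its conclusion holds there (`n = 0`). -/
theorem inGate_std (m : ℕ) :
    Summit.SmoothPoincare4.SmoothPoincare4.Theorems.NormalFormStablyTrivial.Negative.InGate m (N m) := by
  obtain ⟨e⟩ := (Summit.SmoothPoincare4.SmoothPoincare4.Theorems.WaldhausenPairs.Negative.stabilizeIter_isGroupTrisection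
    m).triple
  exact ⟨rfl, rfl, e.toEquiv.subsingleton, ⟨MulEquiv.refl _, by simp, by simp⟩,
    ⟨MulEquiv.refl _, by simp, by simp⟩⟩

/-- The standard triple has standard free shadow. -/
theorem freeShadowStandard_N (m : ℕ) : FreeShadowStandard m (N m) := rfl

/-- NON-VACUITY / TIGHTNESS of `TwistGate` at the standard model: hypotheses and conclusion hold. -/
theorem twistGate_std (m : ℕ) :
    Summit.SmoothPoincare4.SmoothPoincare4.Theorems.NormalFormStablyTrivial.Negative.InGate m (N m) ∧
      FreeShadowStandard m (N m) ∧ (N m).IsStablyTrivial :=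
  ⟨inGate_std m, freeShadowStandard_N m,
    Summit.SmoothPoincare4.SmoothPoincare4.Theorems.AgkCor6Sufficiency.Negative.isStablyTrivial_s4Kernels_stabilizeIter
      m⟩

variable {m : ℕ}

/-- `ψ` acts on `S/N₁ = π₁(H₁)` as an inner automorphism (a LUFT TWIST of `H₁` when moreover
`ψ ∈ Stab N₁`; Luft 1978, McCullough 1985: the twist group is the kernel of
`Mod(H₁) → Out π₁(H₁)`, generated by twists about meridian discs) — the calibration predicate of
the twist-glued family. -/
def ActsInnerlyModN1 (m : ℕ) (ψ : S m ≃* S m) : Prop :=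
  ∃ g : S m, ∀ s : S m, ψ s * (g * s * g⁻¹)⁻¹ ∈ N m 1

/-- **An automorphism acting innerly modulo `N₁` fixes every normal subgroup containing `N₁`.** -/
theorem map_eq_of_actsInnerly (M : Subgroup (S m)) [M.Normal] (hle : N m 1 ≤ M)
    (ψ : S m ≃* S m) (hψ : ActsInnerlyModN1 m ψ) : M.map ψ.toMonoidHom = M := by
  obtain ⟨g, hg⟩ := hψ
  apply le_antisymm
  · rintro _ ⟨s, hs, rfl⟩
    have h1 : ψ.toMonoidHom s = (ψ s * (g * s * g⁻¹)⁻¹) * (g * s * g⁻¹) := by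
      simp only [MulEquiv.coe_toMonoidHom, inv_mul_cancel_right]
    rw [h1]
    exact M.mul_mem (hle (hg s)) (Subgroup.Normal.conj_mem inferInstance s hs g)
  · intro s hs
    refine ⟨ψ.symm s, ?_, by simp⟩
    have h2 := hg (ψ.symm s)
    rw [MulEquiv.apply_symm_apply] at h2
    have h3 : ψ.symm s = g⁻¹ * ((s * (g * ψ.symm s * g⁻¹)⁻¹)⁻¹ * s) * g⁻¹⁻¹ := by group
    rw [h3]
    exact Subgroup.Normal.conj_mem inferInstance _ (M.mul_mem (M.inv_mem (hle h2)) hs) g⁻¹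

/-- **Twist-glued ⇒ standard free shadow**: if `K₂ = t N₂` with `t ∈ Stab N₁` acting innerly
modulo `N₁` (a Luft twist of `H₁`), then `K₂ ⊔ N₁ = N₂ ⊔ N₁`: every twist-glued triple lies on the
locus of `TwistGate` (so does Disproof §6's `ℂP²` witness `T_{b₁}N₂`, which is NOT a gate triple —
the `β`-datum of `InGate` is load-bearing there). -/
theorem freeShadowStandard_of_twist (K : TrisectionKernels (3 + 3 * m)) (t : S m ≃* S m)
    (ht1 : (N m 1).map t.toMonoidHom = N m 1) (htin : ActsInnerlyModN1 m t)
    (hK2 : K 2 = (N m 2).map t.toMonoidHom) : FreeShadowStandard m K := by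
  show K 2 ⊔ N m 1 = N m 2 ⊔ N m 1
  calc K 2 ⊔ N m 1 = (N m 2).map t.toMonoidHom ⊔ (N m 1).map t.toMonoidHom := by rw [hK2, ht1]
    _ = (N m 2 ⊔ N m 1).map t.toMonoidHom := (Subgroup.map_sup _ _ _).symm
    _ = N m 2 ⊔ N m 1 := map_eq_of_actsInnerly _ le_sup_right t htin

end Summit.SmoothPoincare4.SmoothPoincare4.Theorems.NormalFormStablyTrivial.Luft

end
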